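import Summits.BirchSwinnertonDyer.BirchSwinnertonDyer.Theorems.ManinLocalTwoThreeNewformPinningFortyEight
import HarnessLib

/-!
# Level 28 (`4 ∣ 28`, genus `2`): `X₀(28)` has NO newform — `S₂(Γ₀(28)) = ℂf₁₄ ⊕ ℂf₁₄(2τ)` is old — so the `X₀(28)`-domain of
# C2 is EMPTY and C2 holds at `N = 28` vacuously — FACT-FREE

Cell bsd-f2-manin, route `ManinLocalTwoThree` (crux C2 `ManinOddAtFour`, stmt-22967: `2² ∣ 28`), prover seat p2 gen 27.  The levels
`N ≤ 48` of the C2 domain `4 ∣ N` are `4, 8, 12, 16` (genus `0`: no cusp forms), `20, 24, 32, 36, 40, 48` (settled fact-free: `|c| = 1`),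
`44` (open) and `28`.  Here `g(X₀(28)) = 2` and both dimensions of `S₂(Γ₀(28))` are OLD: `f₁₄ = η₁η₂η₇η₁₄` (Cremona `14a`) and `f₁₄(2τ)`
(there is no elliptic curve of conductor `28`).  Consequently no `X₀(28)`-datum of any Weierstrass curve exists (a datum carries a
newform of level `28`, i.e. a normalised element of `S₂(Γ₀(28))^{new} = 0`), and C2's `∀`-statement at `N = 28` holds vacuously.

* §1 `f₁₄ = η₁η₂η₇η₁₄ ∈ S₂(Γ₀(14))` (Ligozat certificate); `dim S₂(Γ₀(28)) = g(X₀(28)) = 2` (tree).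
* §2 `ι₁f₁₄ = f₁₄` and `ι₂f₁₄ = 2η₂η₄η₁₄η₂₈` are independent old forms (orders `1`, `2` at `∞`), so `S₂(Γ₀(28))^{old} = S₂(Γ₀(28))`
  and, old and new being disjoint (tree `disjoint_oldSubspace0_newSubspace0_holds`), **`S₂(Γ₀(28))^{new} = 0`**: no newform of level `28`.
* §3 **No `X₀(28)`-datum exists** (`isEmpty_modularParametrizationData_twentyEight`); C2 at `N = 28` (`maninOddAtFour_twentyEight`).

No definition, no named fact, no sorry.  Nothing here proves C2 for all `N`, Manin's conjecture or BSD.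
[cite: AtkinLehner1970, Thm. 5] [cite: DiamondShurman2005, §5.6, Thm. 3.5.1] [cite: CremonaAlgorithms1997, Table 3 (N = 14, 28)]
-/

set_option autoImplicit false
-- lint-debt: the directory name repeats the summit name (sibling precedent `ManinLocalTwoThreeNewformPinningFortyEight.lean`)
set_option linter.dupNamespace false

noncomputable section

open Complex Filter Topology Set Function Asymptotics
open UpperHalfPlane hiding I
open scoped Real Topology Manifold MatrixGroups ModularForm
open ModularForm CongruenceSubgroup Matrix.SpecialLinearGroup
open Literature.NumberTheory.ModularForms
open Literature.NumberTheory.EllipticCurves Literature.NumberTheory.EllipticCurves.ModularForms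

namespace Summit.BirchSwinnertonDyer.BirchSwinnertonDyer.Theorems.ManinLocalTwoThree.NoNewformTwentyEight

open CuspToolkit

/-! ## §1 `f₁₄ ∈ S₂(Γ₀(14))` and `dim S₂(Γ₀(28)) = 2` -/

/-- Ligozat/Newman certificate of `f₁₄ = η₁η₂η₇η₁₄` (`Σδr = Σ(14/δ)r = 24`, `∏δ^{|r|} = 14²`, orders `1,2,7,14 > 0`). [cite: Ligozat1975, Ch. 3] -/
theorem etaCert_fourteen : EtaCert 14 [(1, 1), (2, 1), (7, 1), (14, 1)] 14 := by
  decide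

/-- **`f₁₄ = η₁η₂η₇η₁₄ ∈ S₂(Γ₀(14))`** (as a term: `etaQuotientCuspForm`). [cite: Ligozat1975, Ch. 3] -/
theorem exists_cuspForm_f14 : ∃ F : CuspForm (Gamma0 14) 2, ⇑F = etaQuotient 14 (expFn [(1, 1), (2, 1), (7, 1), (14, 1)]) :=
  ⟨etaQuotientCuspForm 14 _ 2 (by decide) (newmanCond_of_etaCert etaCert_fourteen) etaCert_fourteen.2.2.2.2, rfl⟩

/-- **`dim S₂(Γ₀(28)) = 2`** (the tree's `finrank_cuspForm_two_eq_genusX0_twentyEight`). [cite: DiamondShurman2005, Thm. 3.5.1] -/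
theorem finrank_cuspForm_two_twentyEight : Module.finrank ℂ (CuspForm (Gamma0 28) 2) = 2 :=
  finrank_cuspForm_two_eq_genusX0_twentyEight.2

/-! ## §2 The two old forms fill `S₂(Γ₀(28))`; the new subspace is zero -/

section F

variable (F : CuspForm (Gamma0 14) 2) (hF : ⇑F = etaQuotient 14 (expFn [(1, 1), (2, 1), (7, 1), (14, 1)]))
include hF

/-- `ι₁ f₁₄ = f₁₄` pointwise. [cite: DiamondShurman2005, §5.6] -/
theorem degeneracyMap0_one_f14_apply (τ : ℍ) :
    degeneracyMap0 14 28 1 2 F τ = etaQuotient 14 (expFn [(1, 1), (2, 1), (7, 1), (14, 1)]) τ := by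
  rw [congr_fun (coe_degeneracyMap0_one 14 28 2 (by norm_num) F) τ, hF]

/-- `ι₂ f₁₄ = 2·η₂η₄η₁₄η₂₈` pointwise (`f ↦ 2f(2τ)`). [cite: DiamondShurman2005, §5.6] -/
theorem degeneracyMap0_two_f14_apply (τ : ℍ) :
    degeneracyMap0 14 28 2 2 F τ = 2 * etaQuotient 28 (expFn [(2, 1), (4, 1), (14, 1), (28, 1)]) τ := by
  rw [congr_fun (coe_degeneracyMap0 14 28 2 2 (by norm_num) F) τ, slash_tpD_apply, hF,
    etaQuotient, etaQuotient, etaQuotientC, etaQuotientC, coe_tpD_smul,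
    show Nat.divisors 28 = {1, 2, 4, 7, 14, 28} by decide, show Nat.divisors 14 = {1, 2, 7, 14} by decide]
  rw [Finset.prod_insert (by decide), Finset.prod_insert (by decide), Finset.prod_insert (by decide),
    Finset.prod_insert (by decide), Finset.prod_insert (by decide), Finset.prod_singleton,
    Finset.prod_insert (by decide), Finset.prod_insert (by decide), Finset.prod_insert (by decide), Finset.prod_singleton]
  rw [show expFn [(2, 1), (4, 1), (14, 1), (28, 1)] 1 = 0 by decide, show expFn [(2, 1), (4, 1), (14, 1), (28, 1)] 2 = 1 by decide,
    show expFn [(2, 1), (4, 1), (14, 1), (28, 1)] 4 = 1 by decide, show expFn [(2, 1), (4, 1), (14, 1), (28, 1)] 7 = 0 by decide,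
    show expFn [(2, 1), (4, 1), (14, 1), (28, 1)] 14 = 1 by decide, show expFn [(2, 1), (4, 1), (14, 1), (28, 1)] 28 = 1 by decide,
    show expFn [(1, 1), (2, 1), (7, 1), (14, 1)] 1 = 1 by decide, show expFn [(1, 1), (2, 1), (7, 1), (14, 1)] 2 = 1 by decide,
    show expFn [(1, 1), (2, 1), (7, 1), (14, 1)] 7 = 1 by decide, show expFn [(1, 1), (2, 1), (7, 1), (14, 1)] 14 = 1 by decide]
  simp only [zpow_zero, zpow_one, one_mul]
  have e2 : ((1 : ℕ) : ℂ) * (((2 : ℕ) : ℂ) * (τ : ℂ)) = ((2 : ℕ) : ℂ) * (τ : ℂ) := by push_cast; ring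
  have e4 : ((2 : ℕ) : ℂ) * (((2 : ℕ) : ℂ) * (τ : ℂ)) = ((4 : ℕ) : ℂ) * (τ : ℂ) := by push_cast; ring
  have e14 : ((7 : ℕ) : ℂ) * (((2 : ℕ) : ℂ) * (τ : ℂ)) = ((14 : ℕ) : ℂ) * (τ : ℂ) := by push_cast; ring
  have e28 : ((14 : ℕ) : ℂ) * (((2 : ℕ) : ℂ) * (τ : ℂ)) = ((28 : ℕ) : ℂ) * (τ : ℂ) := by push_cast; ring
  rw [e2, e4, e14, e28]
  norm_num

/-- `ι₁f₁₄/q → 1` at `i∞`. [folklore] -/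
theorem tendsto_degeneracyMap0_one_f14_div :
    Tendsto (fun τ : ℍ ↦ degeneracyMap0 14 28 1 2 F τ / Periodic.qParam 1 (τ : ℂ) ^ (1 : ℤ)) atImInfty (𝓝 1) := by
  have h := tendsto_etaQuotient_div_qParam_zpow 14 (expFn [(1, 1), (2, 1), (7, 1), (14, 1)]) 1 (by decide)
  exact h.congr fun τ ↦ by rw [degeneracyMap0_one_f14_apply F hF]

/-- `ι₂f₁₄/q² → 2` at `i∞`. [folklore] -/
theorem tendsto_degeneracyMap0_two_f14_div :
    Tendsto (fun τ : ℍ ↦ degeneracyMap0 14 28 2 2 F τ / Periodic.qParam 1 (τ : ℂ) ^ (2 : ℤ)) atImInfty (𝓝 2) := by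
  have h := (tendsto_etaQuotient_div_qParam_zpow 28 (expFn [(2, 1), (4, 1), (14, 1), (28, 1)]) 2 (by decide)).const_mul 2
  rw [mul_one] at h
  refine h.congr fun τ ↦ ?_
  rw [degeneracyMap0_two_f14_apply F hF, mul_div_assoc]

/-- **`ι₁f₁₄`, `½ι₂f₁₄` are linearly independent** (orders `1` and `2` at `∞`). [folklore] -/
theorem linearIndependent_degeneracy_f14 :
    LinearIndependent ℂ ![degeneracyMap0 14 28 1 2 F, (2 : ℂ)⁻¹ • degeneracyMap0 14 28 2 2 F] := by
  refine linearIndependent_of_tendsto_div_qParam_zpow _ ![1, 2] (fun i j h ↦ ?_) (fun i ↦ ?_)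
  · fin_cases i <;> fin_cases j <;> simp_all
  · fin_cases i
    · exact tendsto_degeneracyMap0_one_f14_div F hF
    · show Tendsto (fun τ : ℍ ↦ ((2 : ℂ)⁻¹ • degeneracyMap0 14 28 2 2 F) τ / Periodic.qParam 1 (τ : ℂ) ^ (2 : ℤ)) atImInfty (𝓝 1)
      have h := (tendsto_degeneracyMap0_two_f14_div F hF).const_mul (2 : ℂ)⁻¹
      rw [inv_mul_cancel₀ (two_ne_zero' ℂ)] at h
      refine h.congr fun τ ↦ ?_
      rw [CuspForm.IsGLPos.smul_apply, smul_eq_mul, mul_div_assoc]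

omit hF in
/-- `ι_d f₁₄ ∈ S₂(Γ₀(28))^{old}` for `d = 1, 2`. [cite: AtkinLehner1970, §2] -/
theorem degeneracyMap0_f14_mem_old (d : ℕ) [NeZero d] (hd : d = 1 ∨ d = 2) : degeneracyMap0 14 28 d 2 F ∈ oldSubspace0 28 2 := by
  have hidx : (14, d) ∈ {x : ℕ × ℕ | x.1 ∈ Nat.properDivisors 28 ∧ x.1 * x.2 ∣ 28} := by
    rcases hd with rfl | rfl <;> decide
  rw [oldSubspace0]
  exact Submodule.mem_iSup_of_mem ⟨(14, d), hidx⟩ (LinearMap.mem_range_self _ _)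

/-- **`S₂(Γ₀(28))^{old} = S₂(Γ₀(28))`** (two independent old forms in a `2`-dimensional space). [cite: AtkinLehner1970, Thm. 5] -/
theorem oldSubspace0_twentyEight_eq_top : oldSubspace0 28 2 = ⊤ := by
  haveI : FiniteDimensional ℂ (CuspForm (Gamma0 28) 2) := finiteDimensional_cuspForm_gamma0 28 2
  have hv : LinearIndependent ℂ
      ![(⟨degeneracyMap0 14 28 1 2 F, degeneracyMap0_f14_mem_old F 1 (Or.inl rfl)⟩ : oldSubspace0 28 2),
        ⟨(2 : ℂ)⁻¹ • degeneracyMap0 14 28 2 2 F,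
          Submodule.smul_mem _ _ (degeneracyMap0_f14_mem_old F 2 (Or.inr rfl))⟩] := by
    refine (LinearIndependent.of_comp (oldSubspace0 28 2).subtype ?_)
    convert linearIndependent_degeneracy_f14 F hF using 1
    funext i
    fin_cases i <;> rfl
  have h2 : 2 ≤ Module.finrank ℂ (oldSubspace0 28 2) := by simpa using hv.fintype_card_le_finrank
  exact Submodule.eq_top_of_finrank_eq (by
    have := Submodule.finrank_le (oldSubspace0 28 2)
    rw [finrank_cuspForm_two_twentyEight] at this ⊢
    omega)

/-- **`S₂(Γ₀(28))^{new} = 0`**: there is no newform of level `28`. [cite: AtkinLehner1970, Thm. 5] -/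
theorem newSubspace0_twentyEight_eq_bot : newSubspace0 28 2 = ⊥ := by
  have hdisj : Disjoint (oldSubspace0 28 2) (newSubspace0 28 2) := disjoint_oldSubspace0_newSubspace0_holds (N := 28) (k := 2)
  rw [oldSubspace0_twentyEight_eq_top F hF] at hdisj
  exact top_disjoint.mp hdisj

end F

/-- **No normalised newform of weight `2` and level `28` exists.** [cite: CremonaAlgorithms1997, Table 3 (N = 28)] -/
theorem not_isNewform0_twentyEight (g : CuspForm (Gamma0 28) 2) : ¬ IsNewform0 g := by
  intro hg
  obtain ⟨F, hF⟩ := exists_cuspForm_f14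
  have h0 : g = 0 := by
    have h := hg.1
    rw [newSubspace0_twentyEight_eq_bot F hF, Submodule.mem_bot] at h
    exact h
  have h1 : cuspCoeff g 1 = 1 := hg.2.2
  rw [h0, cuspCoeff, CuspForm.coe_zero, UpperHalfPlane.qExpansion_zero, map_zero] at h1
  exact zero_ne_one h1

/-! ## §3 The `X₀(28)`-domain of C2 is empty; C2 at `N = 28` -/

/-- **No Weierstrass curve has an `X₀(28)`-datum** (a datum carries a newform of level `28`). [cite: CremonaAlgorithms1997, Table 3 (N = 28)] -/
theorem isEmpty_modularParametrizationData_twentyEight (W : WeierstrassCurve ℚ) : IsEmpty (ModularParametrizationData W 28) :=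
  ⟨fun D ↦ not_isNewform0_twentyEight D.f D.isNewformOf.1⟩

/-- `2² ∣ 28`: the level `28` lies in C2's `4 ∣ N` world. [folklore] -/
theorem two_sq_dvd_twentyEight : 2 ^ 2 ∣ 28 := ⟨7, by norm_num⟩

/-- **The C2 conclusion on the whole `X₀(28)`-domain, vacuously**: `|c| = 1 ∧ 2 ∤ c` for every lattice-optimal `X₀(28)`-datum of every globally
minimal elliptic curve over `ℚ` — there is none (and `2² ∣ 28`).  FACT-FREE; BSD and C2 for general `N` are NOT proved by this. [folklore] -/
theorem maninOddAtFour_twentyEight :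
    2 ^ 2 ∣ 28 ∧ ∀ (W : WeierstrassCurve ℚ) [W.IsElliptic] [W.IsGloballyMinimal] (D : ModularParametrizationData W 28),
      (∀ z ∈ D.L.lattice, ∃ w ∈ periodLattice D.f, z = D.c * w) → |D.maninConstant| = 1 ∧ ¬ (2 : ℤ) ∣ D.maninConstant :=
  ⟨two_sq_dvd_twentyEight, fun W _ _ D _ ↦ ((isEmpty_modularParametrizationData_twentyEight W).false D).elim⟩

end Summit.BirchSwinnertonDyer.BirchSwinnertonDyer.Theorems.ManinLocalTwoThree.NoNewformTwentyEight

end
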